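import Summits.QuantumFields.YangMills.Theorems.BalabanUVNodesN16ProducersAtBareLedgerReading
import Summits.QuantumFields.YangMills.Theorems.BalabanUVNodesN19RateEdgeHolderD4AtBareLedgerReading
import HarnessLib

/-!
# Route «BalabanUVNodes» (K3⁸ `SpineGivenEndpointR13SepCoPHV`, stmt-QuantumFields-27366), DAG node N16 = NE3 — THE N16 → N19′ JUNCTION KNIT AT THE GENERIC-`cr` BARE LEDGER
# READING (dag-n19-w3 (5) p639625): the twin of p640452 §4 for an arbitrary spine-carrier reading `cr` (file 6 of width seat `pub-ymgap-dag-n16-w4`)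

Cell `pub-ymgap`, width seat `pub-ymgap-dag-n16-w4` (director-ym R399 (3a) ∕ HUMAN RULING D-0149∕D-0154), generation 4, file 6 — the generic-reading companion of file 5
`BalabanUVNodesN16ProducersAtBareLedgerReading` (p640452).  Occasion: dag-n27-c g16 INTENT-5 (bus, 2026-08-28T14:28Z) consumed p640452 §4 BY NAME for the composite's live
storey APB16ᴮ at the witness reading `crOfRecord₁₃VAt K₀ (jc …) sh` and noted «no full off-live twin because p640452 has no generic-`cr` §4».  This file supplies it: dag-n19-w3
(5)'s ★★★ `keyedCoreEdgeHolderD4BFree_of_linkReadingAtBareLedgerReading_finiteVolumeRows` — K3 «v6»'s (B)-free N19′ face, spelled, at the BARE ledger reading for an ARBITRARY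
spine-carrier reading `cr : (F θ hP g₀ os) ↦ SpineCarriers` — with its two per-tuple minimiser rows `hH3 hsel` (nodes N07 ∕ N16) REPLACED by node N16's displayed in-edges, in the
binder texts of p640452 §2 byte for byte:
 * per family a LOOSE leaf `LeafH3sup 4 F.L Nper (ρ F) (ρ F) (c F) D_F` at a radius `ρ F ≤ (ℓ₃ F).ε` on the pinned loose data `D_F = {V ∈ ne3DomOfRecord₁₁ F N 0 0 | V ∈ sfClass 4 F.L
   Nper ((ℓ₃ F).ε ∕ B F) 0}` — [Balaban1985Variational] Thm 1 (9)–(10), KEY-FREE (slot key `…N16H7LooseOfReg910Slot.leafH3sup_loose_of_reg910Slot` or any producer);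
 * (P)-(8) at `(ρ F, εTop F)`, `(ℓ₃ F).ε ≤ εTop F` — Thm 1 sentence 1 with clause (8) read at the PROBLEM level (node N07; this seat's located note, evidence #59 on 20544);
 * Thm 1 sentence 2 at `εTop F` for INTERIOR LOCAL MINIMISERS (p617432 §2b's shape; used by the `hH3` row only — the `hsel` row is uniqueness-free);
 * the rows `ρ F ≤ (ℓ₃ F).b`, `c F ≤ c' F`.
Every other binder (`hlinkBare` = NODE O's bare ledger reading at `cr`, ≈45 lines incl. its κ-threshold row; the three pins; `hmatch hend`; stub 1's rows `hs hr hinc h9`; `hβw`;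
`hWall`; `hradii ∧ hclass`; `2∕3 < β ≤ 1`) and the conclusion are (5)'s, VERBATIM and in (5)'s order.  Proof: ONE application of (5)'s theorem fed with p640452 §2's
`hH3_of_pinnedLoose_of_loose_of_exists8P_locMin` ∕ `hsel_of_pinnedLoose_of_loose_of_exists8P` (the datum-radius rows the `sel` construction reads come from (5)'s own `hmatch` ∕
`hradii` through p640452 §1).  A separate file rather than a v1.1 of p640452 only to keep both under the 400-line rule ((5)'s bill is ≈95 lines of binder text).
`--kind proof --supports stmt-QuantumFields-27366 --as helper` (count-neutral).  `bears_on: R4∕N16 · junction N16 → N19′ · composite N27 (off-live twins)`.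

HONESTY ROWS.  (i) ACCOUNTING, not a discharge: `hH3 hsel` are REPLACED by node N07's two sentences + the loose leaf + scalar rows; nothing of [Balaban1985Variational] is proved.
(ii) (P) is a located READING of clause (8); the dictionary of record reads (8) at the space level (leaf-06 D-s3-2) — on that reading use p640452 §3's CAPTURE-road feeds instead
(one application of (5) each; not restated here).  (iii) `hlinkBare` and every rate ∕ NE7 face are HYPOTHESES (NODE O's world, 0 instances).

HONEST FRAMING.  By-name application over landed theorems; nothing of Bałaban asserted or refuted; no stub of K3⁸ v6 (`stub_rates13HV` ∕ `stub_expansion13HV`) closed or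
claimed; N16 ∕ N19 ∕ N07 ∕ N27 NOT discharged; count-neutral (typed 28∕28 · discharged 5∕27 · A 5∕28 unmoved); one finite four-torus at fixed `ε`, Bałaban AS PRINTED — NOT ℝ⁴,
NOT infinite volume, NOT OS, NOT a mass gap; the YM mass gap (Clay) is NOT proved by any of this — R4 closes the conditional finite-𝕋⁴ rung `BalabanLadder.UV` only; no summit
statement is proved by this seat.

Reference: [Balaban1985Variational] T. Bałaban, CMP **102** (1985) 277–309, Thm 1 p. 279.
-/

set_option autoImplicit false

open scoped BigOperators Matrix Matrix.Norms.L2Operator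
open NormedSpace

namespace Summit.QuantumFields.YangMills.BalabanUVNodes.N16ProducersAtBareLedgerReadingGeneric

open Literature.MathematicalPhysics.QuantumFieldTheory.Balaban1983to89
open Literature.MathematicalPhysics.QuantumFieldTheory.Balaban1983to89.T4Continuum (T4Family ULoop)
open B7Prop1Explicit B7Prop2Explicit MatrixLog UnitaryModel
open T4AveragingDeficitWall hiding Site Plane Plaq Bond
open Summit.QuantumFields.BalabanUV.T4Continuum
open MinimalActionSandwich (IsMinimiser admissible minAct)
open MinimalActionLevels (levelAction)
open MinimalActionRate (sfClass)
open MinimalActionRefine (RegularSup gradConst)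
open NE3.LeafIndexSockets (LeafH3sup)
open NE3EnergyShapes (IsUnitarySite IsPeriodicSite)
open Node00 (Stage13HParams NE3Letters₁₁ ne3NperOfRecord₁₁ ne3DomOfRecord₁₁ MatA datumOfRecord₁₃CoPH U3Letters₁₁)
open YMDAG.UVSplit (RateReading₁₃CoPH rateCarriersOfRecord₁₃CoPH SpineCarriers RateCarriers ReadOutAt Datum)
open Summit.QuantumFields.YangMills.BalabanUVNodes.N16PinnedLayer13CoPH (N16PinnedLoose N16LettersEnd)
open Summit.QuantumFields.YangMills.BalabanUVNodes.N16ProducersAtBareLedgerReading (hH3_of_pinnedLoose_of_loose_of_exists8P_locMin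
  hsel_of_pinnedLoose_of_loose_of_exists8P)
-- vocabulary of dag-n19-w3's (5) `…N19RateEdgeHolderD4AtBareLedgerReading` (for the restated bill)
open Finset MeasureTheory
open T4OutputRate T4RecentScale T4GoodClassBudget T4CauchySum T4TowerRateComposition T4TowerRateDischarge
open T4EtaRateMin (Readings NE3Shape)
open T4RateLiaison (GaugeDominated)
open FlowStep (RGEqH prefixOf)
open TreeLengthTorus (TFaceConnected torusTreeLen)
open B12TreeDecay (kappa₀)
open Summit.QuantumFields.BalabanUV.T4Continuum.Spine
open Summit.QuantumFields.BalabanUV.T4Continuum.Spine.NE4 (runFlow)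
open Summit.QuantumFields.YangMills.BalabanUVNodes.N19LedgerLinkSync (LedgerDataSync LedgerAtSync)
open Summit.QuantumFields.YangMills.BalabanUVNodes.SpineRatesHolder (RatesHolderAt)
open YMDAG.N14.TopBorn (Ne1PinnedOfRecord)
open Literature.MathematicalPhysics.QuantumFieldTheory.Balaban1983to89.Node00.U3OfKernels (objectsOfRecord₁₃)
open Literature.MathematicalPhysics.QuantumFieldTheory.Balaban1983to89.Node00.U3KernelLetters (WindowedNE9OfRecord₁₃ WindowedDecayOfRecord₁₃ GeometricIncrementsOfRecord₁₃)
open T4ContinuumYM4Torus (ForSmallCouplings)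
open Summit.QuantumFields.YangMills.BalabanUVNodes.N19RateEdgeHolderD4AtBareLedgerReading
  (keyedCoreEdgeHolderD4BFree_of_linkReadingAtBareLedgerReading_finiteVolumeRows)

noncomputable section

variable {N : ℕ} [NeZero N]

/-! ## §1 ★★★ The knit at the generic-`cr` bare ledger reading: dag-n19-w3 (5)'s bill with `hH3 hsel` REPLACED by node N16's displayed in-edges -/

/-- **★★★ THE N16 → N19′ JUNCTION KNIT AT AN ARBITRARY SPINE-CARRIER READING `cr`.**  dag-n19-w3 (5)'s
`keyedCoreEdgeHolderD4BFree_of_linkReadingAtBareLedgerReading_finiteVolumeRows` with its two per-tuple rows `hH3 hsel` (nodes N07 ∕ N16's minimiser rows) REPLACED by node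
N16's displayed in-edges (p640452 §2's binder texts): per family a loose leaf at `ρ F ≤ (ℓ₃ F).ε` on the pinned loose data (Thm 1 (9)–(10), key-free), (P)-(8) at
`(ρ F, εTop F)` (Thm 1 sentence 1 at the problem level), sentence 2 at `εTop F` for interior local minimisers (for `hH3` only), and the rows `ρ F ≤ (ℓ₃ F).b`, `c F ≤ c' F`.
EVERY OTHER BINDER IS (5)'s, VERBATIM and in its order, and so is the conclusion.  Proof: (5)'s theorem fed with p640452 §2.  ONE FACE-SHAPE modulo displayed hypotheses — NOT
`stub_expansion13HV`, NOT K3⁸; N07 ∕ N16 ∕ N19 ∕ N27 NOT discharged. [cite: Balaban1985Variational, Thm 1 (8)–(10) p.279] -/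
theorem keyedCoreEdgeHolderD4BFree_of_bareLedgerReading_of_pinnedLoose_of_loose_of_exists8P
    (cr : (F : T4Family) → (θ : Stage13HParams F N) → θ.Provisos₁₃CoPH F N → (ℕ → ℝ) → List (ULoop F) → SpineCarriers)
    (𝔯 : RateReading₁₃CoPH N) (G : ∀ {F : T4Family}, Stage13HParams F N → Prop) {β : ℝ} (hβ1 : β ≤ 1)
    {ℓ₃ : T4Family → NE3Letters₁₁} {g B c' : T4Family → ℝ}
    (hlinkBare : ∀ (F : T4Family) (θ : Stage13HParams F N) (hP : θ.Provisos₁₃CoPH F N), G θ → θ.Admissible F N →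
    ∀ (γ gIR b : ℝ) (g₀ : ℕ → ℝ), (datumOfRecord₁₃CoPH F N θ hP).Tuned γ gIR g₀ → γ ≤ θ.γ → γ ^ 2 ≤ Real.exp (-1) → 0 < b →
    (∀ K m, 0 ≤ m → m < K → b ≤ (datumOfRecord₁₃CoPH F N θ hP).βfun m (prefixOf (runFlow (datumOfRecord₁₃CoPH F N θ hP) g₀ K) m)) →
    ∀ (os : List (ULoop F)) (k : ℕ),
      let S : SpineCarriers := cr F θ hP g₀ os
      let R : RateCarriers N := rateCarriersOfRecord₁₃CoPH 𝔯 F θ hP g₀ os k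
      let D : Datum F N := datumOfRecord₁₃CoPH F N θ hP
      letI := S.dec
      ∃ (_ : DecidableEq R.u3.C.Dom) (F' : Type) (ι' X' : Type) (_ : MeasurableSpace ι')
        (L : LedgerDataSync R.u3.C F' ι' S.ι) (Rd : Readings ι' X') (bsel : (ℕ → ℝ) → ℝ) (EB : Functional R.u3.C R.u3.C.BgB)
        (g : ℕ → ℕ → ℝ)
        (uA : ℕ → ι' → R.u3.C.BgA) (uB : ℕ → ι' → R.u3.C.BgB)
        (Pf : ℕ → Params) (d₀ L₀ Koff : ℕ) (cells : (K j : ℕ) → R.u3.C.Dom → Finset (Site (Pf K) j))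
        (θ : ℝ)
        (rd : ι' → (B7Prop1Explicit.Site 4 → Fin 4 → (Matrix (Fin N) (Fin N) ℂ)ˣ)),
        (∀ K i, i ≤ K → g K i = runFlow D g₀ K i) ∧ (∀ K i, K < i → g K i = gIR) ∧
        EB = (fun s => R.u3.EB (bsel s) s) ∧
        (∀ (Sz : ℕ → ℝ → S.ι → ℕ → ℝ) (E₀ : ℝ) (m : ℕ) (a : ℝ) (Cw Λg : ℝ),
          (∀ K t, |t| ≤ S.l₀ → ∀ τ ∈ S.T K \ S.Bad K t, ∀ v ∈ Rd.dom, ∀ j ≤ K,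
            |∑ X ∈ L.fac K t τ with R.u3.C.scale X = j,
                (Real.log (Real.exp (EB (fun i => g (K + 1) (i + 1)) (uB K v) X
                    - EB (fun i => g (K + 1) (i + 1)) L.oneB X))
                  - Real.log (Real.exp (R.u3.EA (g K) (uA K v) X - R.u3.EA (g K) L.oneA X)))| ≤ Sz K t τ j) →
          0 ≤ E₀ → 0 < a → a < 1 →
          (∀ K t, |t| ≤ S.l₀ → ∀ τ ∈ S.T K \ S.Bad K t, ∀ j ≤ K,
            Sz K t τ j ≤ S.vol * (E₀ * ((K : ℝ) + 1) ^ m * a ^ (K - j))) →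
          (∀ K, Multiplicity (L.All K) R.u3.C.scale (fun X => Real.exp (-(R.u3.κ * R.u3.C.d X))) Cw S.vol Λg K) →
          (∀ K t, |t| ≤ S.l₀ → ∀ τ ∈ S.T K \ S.Bad K t,
            WindowMultiplicity (L.facO K t τ) L.scO L.wO Cw S.vol Λg (jlogOf L.Cl K) K) →
          1 ≤ Λg → L.θ' ≤ Λg →
          LedgerAtSync { L with S := Sz, E₀ := E₀, m := m, a := a, Cw := Cw, Λg := Λg } S.l₀ S.vol S.T S.Bad
            (fun K t τ => S.A K t τ - S.shA K t τ) (fun K t τ => S.B K t τ - S.shB K t τ) Rd R.u3.EA EB R.u3.κ g uA uB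
            R.u3.ω R.u3.ρ R.u3.θ (θ ^ ((3 : ℝ) * β - 2))) ∧
        0 ≤ S.vol ∧
        (∀ K t, |t| ≤ S.l₀ → ∀ τ ∈ S.T K \ S.Bad K t,
          WindowMultiplicity (L.facO K t τ) L.scO L.wO L.Cw S.vol L.Λg (jlogOf L.Cl K) K) ∧
        0 ≤ L.Cw ∧ 1 ≤ L.Λg ∧ L.θ' ≤ L.Λg ∧
        (∀ K, (Pf K).d = d₀) ∧ (∀ K, (Pf K).L = L₀) ∧ (∀ K, (Pf K).K = Koff + K) ∧
        (∀ K, (Fintype.card (Site (Pf K) (Pf K).K) : ℝ) = S.vol) ∧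
        kappa₀ (4 * 2 ^ d₀) (2 * d₀) ≤ R.u3.κ ∧
        (∀ K, ∀ X ∈ L.All K,
          (cells K (R.u3.C.scale X + Koff) X).Nonempty ∧ TFaceConnected (cells K (R.u3.C.scale X + Koff) X)) ∧
        (∀ K j, Set.InjOn (cells K j) ↑((L.All K).filter fun X => R.u3.C.scale X + Koff = j)) ∧
        (∀ K, ∀ X ∈ L.All K, torusTreeLen (cells K (R.u3.C.scale X + Koff) X) ≤ R.u3.C.d X) ∧
        0 < θ ∧ θ ^ 6 = ((R.ne3.L : ℝ))⁻¹ ∧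
        (∀ v ∈ Rd.dom, rd v ∈ R.ne3.dom) ∧
        (∀ k, ∀ v ∈ Rd.dom, Rd.act k v = minAct 4 (sfClass 4 R.ne3.L R.ne3.Nper R.ne3.ε) R.ne3.L R.ne3.Nper k (rd v)) ∧
        (R.ne3.Nper : ℝ) ^ 4 ≤ Rd.vol ∧
        (∀ s ∈ Window γ, 0 < bsel s ∧ bsel s ≤ γ)) (hβ23 : 2 / 3 < β) (hpin1 : Ne1PinnedOfRecord 𝔯)
    (ℓ : (F : T4Family) → Stage13HParams F N → U3Letters₁₁)
    (hpinU3 : ∀ (F : T4Family) (θ : Stage13HParams F N) (hP : θ.Provisos₁₃CoPH F N) (g₀ : ℕ → ℝ) (os : List (ULoop F)),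
      (𝔯.lit F θ hP g₀ os).u3 = objectsOfRecord₁₃ F N θ.toStage13Params (ℓ F θ))
    (hpinL : N16PinnedLoose 𝔯 ℓ₃ B) (hmatch : ∀ F : T4Family, 0 < B F ∧ (ℓ₃ F).ε / B F ≤ (ℓ₃ F).b) (hend : N16LettersEnd N g ℓ₃)
    (hradii : ∀ F : T4Family, (ℓ₃ F).g = gradConst 4 (c' F) ∧ 0 ≤ c' F ∧ 0 < c' F ∧ (ℓ₃ F).b ≤ c' F ∧
      (2 : ℝ) ^ 91 * (F.L : ℝ) ^ 17 * c' F ≤ 1 ∧ (2 : ℝ) ^ 76 * (F.L : ℝ) ^ 12 * c' F ≤ (ℓ₃ F).ε ∧ (ℓ₃ F).ε / B F ≤ 1 / 4 ∧ 4 * ((ℓ₃ F).ε / B F) ≤ c' F)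
    (hclass : ∀ F : T4Family, 16 * B7Prop2Explicit.C0 4 * (ℓ₃ F).ε ≤ 3 ∧ 1024 * (4 + 1) * (4 + 4) * (F.L : ℝ) ^ 2 * (ℓ₃ F).ε ≤ 1)
    {ρ c εTop : T4Family → ℝ}
    (hloose : ∀ F : T4Family, LeafH3sup 4 F.L (ne3NperOfRecord₁₁ F 0 0) (ρ F) (ρ F) (c F)
      ({V | V ∈ ne3DomOfRecord₁₁ F N 0 0 ∧ V ∈ sfClass 4 F.L (ne3NperOfRecord₁₁ F 0 0) ((ℓ₃ F).ε / B F) 0} : Set (Site 4 → Fin 4 → (MatA N)ˣ)))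
    (hρε : ∀ F : T4Family, ρ F ≤ (ℓ₃ F).ε) (hεT : ∀ F : T4Family, (ℓ₃ F).ε ≤ εTop F)
    (h8P : ∀ (F : T4Family), ∀ V ∈ ({V | V ∈ ne3DomOfRecord₁₁ F N 0 0 ∧ V ∈ sfClass 4 F.L (ne3NperOfRecord₁₁ F 0 0) ((ℓ₃ F).ε / B F) 0} :
        Set (Site 4 → Fin 4 → (MatA N)ˣ)), ∀ k : ℕ, ∃ U₀ : Site 4 → Fin 4 → (MatA N)ˣ,
      U₀ ∈ sfClass 4 F.L (ne3NperOfRecord₁₁ F 0 0) (ρ F) (k + 1) ∧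
        IsMinimiser 4 (sfClass 4 F.L (ne3NperOfRecord₁₁ F 0 0) (εTop F)) F.L (ne3NperOfRecord₁₁ F 0 0) (k + 1) V U₀)
    (hU6loc : ∀ (F : T4Family) (k : ℕ), ∀ V ∈ ({V | V ∈ ne3DomOfRecord₁₁ F N 0 0 ∧ V ∈ sfClass 4 F.L (ne3NperOfRecord₁₁ F 0 0) ((ℓ₃ F).ε / B F) 0} :
        Set (Site 4 → Fin 4 → (MatA N)ˣ)),
      ∀ U₀ : Site 4 → Fin 4 → (MatA N)ˣ, IsMinimiser 4 (sfClass 4 F.L (ne3NperOfRecord₁₁ F 0 0) (ρ F)) F.L (ne3NperOfRecord₁₁ F 0 0) (k + 1) V U₀ →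
      ∀ U : Site 4 → Fin 4 → (MatA N)ˣ, U ∈ sfClass 4 F.L (ne3NperOfRecord₁₁ F 0 0) (εTop F) (k + 1) → avgIter F.L U (k + 1) = V →
        U ∈ sfClass 4 F.L (ne3NperOfRecord₁₁ F 0 0) (ℓ₃ F).ε (k + 1) →
        IsLocalMinOn (fun W : Site 4 → Fin 4 → (MatA N)ˣ => levelAction 4 F.L (ne3NperOfRecord₁₁ F 0 0) (k + 1) W)
          (admissible (sfClass 4 F.L (ne3NperOfRecord₁₁ F 0 0) (εTop F)) F.L (k + 1) V) U →
        ∃ u : Site 4 → (MatA N)ˣ, IsUnitarySite u ∧ IsPeriodicSite u ((ne3NperOfRecord₁₁ F 0 0 * F.L ^ (k + 1) : ℕ) : ℤ) ∧ gaugeAct u U₀ = U)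
    (hρb : ∀ F : T4Family, ρ F ≤ (ℓ₃ F).b) (hc : ∀ F : T4Family, c F ≤ c' F)
    (hs : ∀ (F : T4Family) (θ : Stage13HParams F N), θ.Provisos₁₃CoPH F N → G θ → θ.Admissible F N → (ℓ F θ).Signs)
    (r : (F : T4Family) → Stage13HParams F N → ℝ)
    (hr : ∀ (F : T4Family) (θ : Stage13HParams F N), θ.Provisos₁₃CoPH F N → G θ → θ.Admissible F N → r F θ < 1)
    (hinc : ∀ (F : T4Family) (θ : Stage13HParams F N), θ.Provisos₁₃CoPH F N → G θ → θ.Admissible F N →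
      GeometricIncrementsOfRecord₁₃ F N θ.toStage13Params (r F θ))
    (h9 : ∀ (F : T4Family) (θ : Stage13HParams F N), θ.Provisos₁₃CoPH F N → G θ → θ.Admissible F N →
      WindowedNE9OfRecord₁₃ F N θ.toStage13Params (ℓ F θ).κ (ℓ F θ).moduli)
    (hWall : ∀ (μ ν : Fin 4) (F : T4Family) (θ : Stage13HParams F N), θ.Provisos₁₃CoPH F N → G θ → θ.Admissible F N →
      WindowedDecayOfRecord₁₃ F N θ.toStage13Params μ ν (ℓ F θ).κ)
    (ks : (F : T4Family) → (θ : Stage13HParams F N) → θ.Provisos₁₃CoPH F N → (ℕ → ℝ) → List (ULoop F) → ℕ)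
    (hβw : ∀ (F : T4Family) (θ : Stage13HParams F N) (hP : θ.Provisos₁₃CoPH F N), G θ → θ.Admissible F N →
      ∃ γ₀ b b' : ℝ, 0 < γ₀ ∧ 0 < b ∧ DagBinding.BetaBoundsInInterval (datumOfRecord₁₃CoPH F N θ hP).C.toB12 γ₀ b b') :
    ∀ (F : T4Family) (θ : Stage13HParams F N) (hP : θ.Provisos₁₃CoPH F N), G θ → θ.Admissible F N →
      ForSmallCouplings (datumOfRecord₁₃CoPH F N θ hP) fun g₀ => ∀ os : List (ULoop F),
        (RatesHolderAt (datumOfRecord₁₃CoPH F N θ hP) (rateCarriersOfRecord₁₃CoPH 𝔯 F θ hP g₀ os (ks F θ hP g₀ os)) β ∧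
          ReadOutAt (datumOfRecord₁₃CoPH F N θ hP) (rateCarriersOfRecord₁₃CoPH 𝔯 F θ hP g₀ os (ks F θ hP g₀ os)).u3 ∧
          (0 ≤ (rateCarriersOfRecord₁₃CoPH 𝔯 F θ hP g₀ os (ks F θ hP g₀ os)).u3.ρ ∧ (rateCarriersOfRecord₁₃CoPH 𝔯 F θ hP g₀ os (ks F θ hP g₀ os)).u3.ρ < 1)) →
        letI := (cr F θ hP g₀ os).dec
        ∃ δ : ℕ → ℝ, NE7.Core (cr F θ hP g₀ os).l₀ (cr F θ hP g₀ os).vol (cr F θ hP g₀ os).T (cr F θ hP g₀ os).Bad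
          (fun K t τ => (cr F θ hP g₀ os).A K t τ - (cr F θ hP g₀ os).shA K t τ) (fun K t τ => (cr F θ hP g₀ os).B K t τ - (cr F θ hP g₀ os).shB K t τ) δ ∧
          Summable δ :=
  keyedCoreEdgeHolderD4BFree_of_linkReadingAtBareLedgerReading_finiteVolumeRows cr 𝔯 G hβ1 hlinkBare hβ23 hpin1 ℓ hpinU3 hpinL hmatch hend hradii hclass
    (hH3_of_pinnedLoose_of_loose_of_exists8P_locMin hpinL hloose hρε hεT h8P hU6loc hρb hc)
    (hsel_of_pinnedLoose_of_loose_of_exists8P hpinL hloose hρε hεT h8P hρb hc hmatch hradii) hs r hr hinc h9 hWall ks hβw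

end

end Summit.QuantumFields.YangMills.BalabanUVNodes.N16ProducersAtBareLedgerReadingGeneric
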